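import Mathlib
import Summits.Ventures.PercRepro2.Defs
import Summits.Ventures.PercRepro2.Graph
import Summits.Ventures.PercRepro2.OneColourSwitch
import Summits.Ventures.PercRepro2.RegionHubSign
import Summits.Ventures.PercRepro2.SideSwitch
import Summits.Ventures.PercRepro2.SideSwitchFibre

/-!
# Monotonicity on the hypercube of side assignments (blind cell PercRepro2, p3 g18, 2026-08-27;
`proofs/P3-CPNC.md` §15e)

For a representative `ρ` and side assignments `T ⊆ T' ⊆ A0`: `p ~_Y q` is increasing
(`conn_pq_assign_mono`), `r ~_Y s` decreasing (`conn_rs_assign_anti`) and `r ~_W s` increasing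
(`conn_rs_compl_assign_mono`) — three applications of the domain-Markov path lemma
`conn_of_eqOn_notTouches` — and the complement identity `conn_pq_compl_assign`: `p ~_W q` in
the assignment `T` is `p ~_Y q` in the assignment `A0 ∖ T` of the outside-flipped representative
(the two colourings differ only on the `r`–`s` edges, `compl_assign_eq_off_rs`).
Own work; std axioms.
-/

namespace Summit.Ventures.PercRepro2

namespace SideSwitch

open Finset Classical RegionHub OneColourSwitch

variable {V : Type*} {E : Type*}
variable {ends : E → Sym2 V}

section Count

variable [Fintype V] [DecidableEq V] [Fintype E] [DecidableEq E]

/-! ## Monotonicity on the hypercube -/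

omit [Fintype V] [Fintype E] [DecidableEq E] in
/-- Two side assignments agree off the edges touching their difference. -/
lemma assign_eq_of_notMem_touches_sdiff {ω : Config E} {T T' : Finset V} (hTT : T ⊆ T') {e : E}
    (he : e ∉ touches ends (↑(T' \ T) : Set V)) : assign ends T' ω e = assign ends T ω e := by
  have key : e ∈ touches ends (↑T' : Set V) ↔ e ∈ touches ends (↑T : Set V) := by
    constructor
    · rintro ⟨x, hx, y, hxy⟩
      by_cases hxT : x ∈ T
      · exact ⟨x, hxT, y, hxy⟩
      · exact (he ⟨x, Finset.mem_coe.2 (Finset.mem_sdiff.2 ⟨Finset.mem_coe.1 hx, hxT⟩), y, hxy⟩).elim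
    · rintro ⟨x, hx, y, hxy⟩
      exact ⟨x, hTT hx, y, hxy⟩
  simp only [assign, flipTouch]
  by_cases h1 : e ∈ touches ends (↑T' : Set V)
  · rw [if_pos h1, if_pos (key.1 h1)]
  · rw [if_neg h1, if_neg (fun h2 => h1 (key.2 h2))]

/-- A vertex of `T' ∖ T` lies on the `Y`-side of the assignment `T` of a representative. -/
lemma side_of_mem_sdiff {p q r s : V} {ρ : Config E} (hno : NoNonmarkEdge ends p q r s)
    (hρ : ρ ∈ Rep ends p q r s) {T T' : Finset V} (hTT : T ⊆ T') (hT' : T' ⊆ A0 ends r s ρ)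
    {x : V} (hx : x ∈ T' \ T) :
    x ∈ K2 ends r s (assign ends T ρ) ∧ x ∉ M2 ends r s (assign ends T ρ) := by
  obtain ⟨h, hM⟩ := mem_Rep.1 hρ
  have hTA : T ⊆ A0 ends r s ρ := hTT.trans hT'
  obtain ⟨hC, hCr, hCs⟩ := subset_U2_of_subset_A0 hTA
  obtain ⟨hxT', hxT⟩ := Finset.mem_sdiff.1 hx
  have hxA : x ∈ A0 ends r s ρ := hT' hxT'
  have hxK : x ∈ K2 ends r s ρ := A0_subset_K2_of_mem_Rep hρ hxA
  obtain ⟨_, hxr, hxs⟩ := mem_A0.1 hxA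
  simp only [assign]
  rw [K2_flipTouch hno h hC hCr hCs, M2_flipTouch hno h hC hCr hCs]
  refine ⟨Or.inl ⟨hxK, fun h' => hxT (Finset.mem_coe.1 h')⟩, ?_⟩
  rintro (⟨hxM, _⟩ | ⟨hxT'', _⟩)
  · rcases hM x hxM with h' | h'
    · exact hxr h'
    · exact hxs h'
  · exact hxT (Finset.mem_coe.1 hxT'')

/-- (M1) `p ~_Y q` is increasing in the side assignment. -/
lemma conn_pq_assign_mono {p q r s : V} {ρ : Config E} (hno : NoNonmarkEdge ends p q r s)
    (hρ : ρ ∈ Rep ends p q r s) {T T' : Finset V} (hTT : T ⊆ T') (hT' : T' ⊆ A0 ends r s ρ)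
    (hc : Conn ends (assign ends T ρ) p q) : Conn ends (assign ends T' ρ) p q := by
  have hsep : sep2 ends p q r s (assign ends T ρ) :=
    sep2_assign hno (mem_Rep.1 hρ).1 (hTT.trans hT')
  refine conn_of_eqOn_notTouches (H := ({r, s} : Set V)) (ω := assign ends T ρ)
    (ω' := assign ends T' ρ) (not_mem_K2_of_sep2 hsep).1 ?_ hc
  intro e he
  refine assign_eq_of_notMem_touches_sdiff hTT ?_
  rintro ⟨x, hx, y, hxy⟩
  exact he ⟨x, (side_of_mem_sdiff hno hρ hTT hT' (Finset.mem_coe.1 hx)).1, y, hxy⟩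

/-- A vertex of `T` lies on the `W`-side of the assignment `T` of a representative. -/
lemma side_of_mem {p q r s : V} {ρ : Config E} (hno : NoNonmarkEdge ends p q r s)
    (hρ : ρ ∈ Rep ends p q r s) {T : Finset V} (hT : T ⊆ A0 ends r s ρ) {x : V} (hx : x ∈ T) :
    x ∉ K2 ends r s (assign ends T ρ) ∧ x ∈ M2 ends r s (assign ends T ρ) := by
  obtain ⟨h, hM⟩ := mem_Rep.1 hρ
  obtain ⟨hC, hCr, hCs⟩ := subset_U2_of_subset_A0 hT
  have hxK : x ∈ K2 ends r s ρ := A0_subset_K2_of_mem_Rep hρ (hT hx)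
  obtain ⟨_, hxr, hxs⟩ := mem_A0.1 (hT hx)
  simp only [assign]
  rw [K2_flipTouch hno h hC hCr hCs, M2_flipTouch hno h hC hCr hCs]
  refine ⟨?_, Or.inr ⟨Finset.mem_coe.2 hx, hxK⟩⟩
  rintro (⟨_, hxT⟩ | ⟨_, hxM⟩)
  · exact hxT (Finset.mem_coe.2 hx)
  · rcases hM x hxM with h' | h'
    · exact hxr h'
    · exact hxs h'

/-- (M2) `r ~_Y s` is decreasing in the side assignment. -/
lemma conn_rs_assign_anti {p q r s : V} {ρ : Config E} (hno : NoNonmarkEdge ends p q r s)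
    (hρ : ρ ∈ Rep ends p q r s) {T T' : Finset V} (hTT : T ⊆ T') (hT' : T' ⊆ A0 ends r s ρ)
    (hc : Conn ends (assign ends T' ρ) r s) : Conn ends (assign ends T ρ) r s := by
  refine conn_of_eqOn_notTouches (H := (↑(T' \ T) : Set V)) (ω := assign ends T' ρ)
    (ω' := assign ends T ρ) ?_ ?_ hc
  · rintro ⟨x, hx, hxr⟩
    have hxT' : x ∈ T' := (Finset.mem_sdiff.1 (Finset.mem_coe.1 hx)).1
    exact (side_of_mem hno hρ hT' hxT').1 (mem_K2_iff.2 (Or.inl (conn_symm hxr)))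
  · intro e he
    refine (assign_eq_of_notMem_touches_sdiff hTT ?_).symm
    rintro ⟨x, hx, y, hxy⟩
    exact he ⟨x, ⟨x, hx, conn_refl _ _ _⟩, y, hxy⟩

/-- (M3) `r ~_W s` is increasing in the side assignment. -/
lemma conn_rs_compl_assign_mono {p q r s : V} {ρ : Config E} (hno : NoNonmarkEdge ends p q r s)
    (hρ : ρ ∈ Rep ends p q r s) {T T' : Finset V} (hTT : T ⊆ T') (hT' : T' ⊆ A0 ends r s ρ)
    (hc : Conn ends (OneColourSwitch.compl (assign ends T ρ)) r s) :
    Conn ends (OneColourSwitch.compl (assign ends T' ρ)) r s := by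
  refine conn_of_eqOn_notTouches (H := (↑(T' \ T) : Set V))
    (ω := OneColourSwitch.compl (assign ends T ρ))
    (ω' := OneColourSwitch.compl (assign ends T' ρ)) ?_ ?_ hc
  · rintro ⟨x, hx, hxr⟩
    exact (side_of_mem_sdiff hno hρ hTT hT' (Finset.mem_coe.1 hx)).2
      (mem_M2_iff.2 (Or.inl (conn_symm hxr)))
  · intro e he
    have hnt : e ∉ touches ends (↑(T' \ T) : Set V) := by
      rintro ⟨x, hx, y, hxy⟩
      exact he ⟨x, ⟨x, hx, conn_refl _ _ _⟩, y, hxy⟩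
    simp only [OneColourSwitch.compl]
    rw [assign_eq_of_notMem_touches_sdiff hTT hnt]

omit [Fintype E] [DecidableEq E] in
/-- Every vertex is `r`, `s`, a vertex of `A0`, or outside. -/
lemma vertex_cases {r s : V} (ρ : Config E) (x : V) :
    x = r ∨ x = s ∨ x ∈ A0 ends r s ρ ∨ x ∈ Oset ends r s ρ := by
  by_cases hU : x ∈ K2 ends r s ρ ∪ M2 ends r s ρ
  · by_cases hr : x = r
    · exact Or.inl hr
    by_cases hs : x = s
    · exact Or.inr (Or.inl hs)
    exact Or.inr (Or.inr (Or.inl (mem_A0.2 ⟨hU, hr, hs⟩)))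
  · exact Or.inr (Or.inr (Or.inr hU))

omit [Fintype E] [DecidableEq E] in
/-- An edge does not touch both `T` and its complement in `A0` (no two non-marks adjacent). -/
lemma not_touches_both {p q r s : V} {ρ : Config E} (hno : NoNonmarkEdge ends p q r s)
    (h : sep2 ends p q r s ρ) {T : Finset V} (hT : T ⊆ A0 ends r s ρ) {e : E}
    (h1 : e ∈ touches ends (↑T : Set V)) (h2 : e ∈ touches ends (↑(A0 ends r s ρ \ T) : Set V)) :
    False := by
  obtain ⟨x, hx, y, hxy⟩ := h1
  obtain ⟨z, hz, w, hzw⟩ := h2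
  have hxA := mem_A0.1 (hT (Finset.mem_coe.1 hx))
  have hzA := mem_A0.1 (Finset.mem_sdiff.1 (Finset.mem_coe.1 hz)).1
  have hzT : z ∉ T := (Finset.mem_sdiff.1 (Finset.mem_coe.1 hz)).2
  have hnx : Nonmark p q r s x := nonmark_of_mem_U2 h hxA.1 hxA.2.1 hxA.2.2
  have hnz : Nonmark p q r s z := nonmark_of_mem_U2 h hzA.1 hzA.2.1 hzA.2.2
  rw [hxy, Sym2.eq_iff] at hzw
  rcases hzw with ⟨h1', _⟩ | ⟨_, h2'⟩
  · exact hzT (h1' ▸ Finset.mem_coe.1 hx)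
  · refine hno e x y hxy hnx ?_
    rw [h2']
    exact hnz

omit [Fintype E] [DecidableEq E] in
/-- An edge touching `A0` is not inside the outside. -/
lemma not_within_Oset_of_touches_A0 {r s : V} {ρ : Config E} {e : E} {T : Finset V}
    (hT : T ⊆ A0 ends r s ρ) (h1 : e ∈ touches ends (↑T : Set V)) :
    e ∉ within ends (Oset ends r s ρ) := by
  obtain ⟨x, hx, y, hxy⟩ := h1
  exact not_mem_within_Oset_of_mem_touches ⟨x, (mem_A0.1 (hT (Finset.mem_coe.1 hx))).1, y, hxy⟩

/-- **The complement identity, pointwise**: off the `r`–`s` edges, the complement of the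
assignment `T` is the assignment `A0 ∖ T` of the outside-flipped representative. -/
lemma compl_assign_eq_off_rs {p q r s : V} {ρ : Config E} (hno : NoNonmarkEdge ends p q r s)
    (hρ : ρ ∈ Rep ends p q r s) {T : Finset V} (hT : T ⊆ A0 ends r s ρ) {e : E}
    (he : e ∉ within ends ({r, s} : Set V)) :
    OneColourSwitch.compl (assign ends T ρ) e =
      assign ends (A0 ends r s ρ \ T) (flipIn ends (Oset ends r s ρ) ρ) e := by
  obtain ⟨h, _⟩ := mem_Rep.1 hρ
  have hTc : A0 ends r s ρ \ T ⊆ A0 ends r s ρ := Finset.sdiff_subset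
  obtain ⟨x, y, hxy⟩ : ∃ x y, ends e = s(x, y) := Sym2.ind (fun x y => ⟨x, y, rfl⟩) (ends e)
  simp only [OneColourSwitch.compl, assign, flipTouch, flipIn]
  by_cases h1 : e ∈ touches ends (↑T : Set V)
  · have h2 : e ∉ touches ends (↑(A0 ends r s ρ \ T) : Set V) := fun h2 => not_touches_both hno h hT h1 h2
    have h3 : e ∉ within ends (Oset ends r s ρ) := not_within_Oset_of_touches_A0 hT h1
    rw [if_pos h1, if_neg h2, if_neg h3, Bool.not_not]
  by_cases h2 : e ∈ touches ends (↑(A0 ends r s ρ \ T) : Set V)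
  · have h3 : e ∉ within ends (Oset ends r s ρ) := not_within_Oset_of_touches_A0 hTc h2
    rw [if_neg h1, if_pos h2, if_neg h3]
  -- neither endpoint is in `A0`: both are in `{r, s} ∪ O`, not both in `{r, s}`
  have hxA : x ∉ A0 ends r s ρ := by
    intro hx
    by_cases hxT : x ∈ T
    · exact h1 ⟨x, Finset.mem_coe.2 hxT, y, hxy⟩
    · exact h2 ⟨x, Finset.mem_coe.2 (Finset.mem_sdiff.2 ⟨hx, hxT⟩), y, hxy⟩
  have hyx : ends e = s(y, x) := by rw [hxy, Sym2.eq_swap]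
  have hyA : y ∉ A0 ends r s ρ := by
    intro hy
    by_cases hyT : y ∈ T
    · exact h1 ⟨y, Finset.mem_coe.2 hyT, x, hyx⟩
    · exact h2 ⟨y, Finset.mem_coe.2 (Finset.mem_sdiff.2 ⟨hy, hyT⟩), x, hyx⟩
  have hcases : ∀ z, z ∉ A0 ends r s ρ → z = r ∨ z = s ∨ z ∈ Oset ends r s ρ := by
    intro z hz
    rcases vertex_cases (ends := ends) (r := r) (s := s) ρ z with h' | h' | h' | h'
    · exact Or.inl h'
    · exact Or.inr (Or.inl h')
    · exact (hz h').elim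
    · exact Or.inr (Or.inr h')
  have hO : ∀ z, z ∈ Oset ends r s ρ → z ∉ K2 ends r s ρ ∧ z ∉ M2 ends r s ρ := by
    intro z hz
    have hz' : z ∉ K2 ends r s ρ ∪ M2 ends r s ρ := hz
    exact ⟨fun h' => hz' (Or.inl h'), fun h' => hz' (Or.inr h')⟩
  have hmark : ∀ z, z = r ∨ z = s → z ∈ ({r, s} : Set V) := by
    rintro z (h' | h')
    · exact Set.mem_insert_iff.2 (Or.inl h')
    · exact Set.mem_insert_iff.2 (Or.inr (Set.mem_singleton_iff.2 h'))
  have hnot : ¬ ((x = r ∨ x = s) ∧ (y = r ∨ y = s)) := by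
    rintro ⟨hx', hy'⟩
    exact he ⟨x, hmark x hx', y, hmark y hy', hxy⟩
  have houtr : ∀ z w, ends e = s(z, w) → z = r ∨ z = s → w ∈ Oset ends r s ρ → False := by
    intro z w hzw hz hw
    rcases hz with rfl | rfl
    · exact not_edge_r_outside h (hO w hw).1 (hO w hw).2 hzw
    · exact not_edge_s_outside h (hO w hw).1 (hO w hw).2 hzw
  rcases hcases x hxA with hx' | hx' | hxO
  · rcases hcases y hyA with hy' | hy' | hyO
    · exact (hnot ⟨Or.inl hx', Or.inl hy'⟩).elim
    · exact (hnot ⟨Or.inl hx', Or.inr hy'⟩).elim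
    · exact (houtr x y hxy (Or.inl hx') hyO).elim
  · rcases hcases y hyA with hy' | hy' | hyO
    · exact (hnot ⟨Or.inr hx', Or.inl hy'⟩).elim
    · exact (hnot ⟨Or.inr hx', Or.inr hy'⟩).elim
    · exact (houtr x y hxy (Or.inr hx') hyO).elim
  · rcases hcases y hyA with hy' | hy' | hyO
    · exact (houtr y x hyx (Or.inl hy') hxO).elim
    · exact (houtr y x hyx (Or.inr hy') hxO).elim
    · have h3 : e ∈ within ends (Oset ends r s ρ) := ⟨x, hxO, y, hyO, hxy⟩
      rw [if_neg h1, if_neg h2, if_pos h3]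

/-- (M4) **The complement identity**: `p ~_W q` in the assignment `T` is `p ~_Y q` in the
assignment `A0 ∖ T` of the outside-flipped representative. -/
lemma conn_pq_compl_assign {p q r s : V} {ρ : Config E} (hno : NoNonmarkEdge ends p q r s)
    (hρ : ρ ∈ Rep ends p q r s) {T : Finset V} (hT : T ⊆ A0 ends r s ρ) :
    Conn ends (OneColourSwitch.compl (assign ends T ρ)) p q ↔
      Conn ends (assign ends (A0 ends r s ρ \ T) (flipIn ends (Oset ends r s ρ) ρ)) p q := by
  have hρO : flipIn ends (Oset ends r s ρ) ρ ∈ Rep ends p q r s := flipIn_mem_Rep hρ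
  have hTc : A0 ends r s ρ \ T ⊆ A0 ends r s (flipIn ends (Oset ends r s ρ) ρ) := by
    rw [A0_flipIn_Oset]; exact Finset.sdiff_subset
  have hsepT : sep2 ends p q r s (assign ends T ρ) := sep2_assign hno (mem_Rep.1 hρ).1 hT
  have hsepTc : sep2 ends p q r s (assign ends (A0 ends r s ρ \ T) (flipIn ends (Oset ends r s ρ) ρ)) :=
    sep2_assign hno (mem_Rep.1 hρO).1 hTc
  have hrs_touch : ∀ {ω : Config E} {e : E}, e ∈ within ends ({r, s} : Set V) →
      e ∈ touches ends (K2 ends r s ω) := by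
    intro ω e hrs
    obtain ⟨z, hz, w, _, hzw⟩ := hrs
    refine ⟨z, ?_, w, hzw⟩
    rcases Set.mem_insert_iff.1 hz with rfl | hz'
    · exact r_mem_K2 _ _ _
    · rw [Set.mem_singleton_iff.1 hz']; exact s_mem_K2 _ _ _
  constructor
  · intro hc
    refine conn_of_eqOn_notTouches (H := ({r, s} : Set V))
      (ω := OneColourSwitch.compl (assign ends T ρ)) (not_mem_M2_of_sep2 hsepT).1 ?_ hc
    intro e he
    refine (compl_assign_eq_off_rs hno hρ hT ?_).symm
    intro hrs
    exact he (hrs_touch hrs)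
  · intro hc
    refine conn_of_eqOn_notTouches (H := ({r, s} : Set V))
      (ω := assign ends (A0 ends r s ρ \ T) (flipIn ends (Oset ends r s ρ) ρ))
      (not_mem_K2_of_sep2 hsepTc).1 ?_ hc
    intro e he
    refine compl_assign_eq_off_rs hno hρ hT ?_
    intro hrs
    exact he (hrs_touch hrs)


end Count

end SideSwitch

end Summit.Ventures.PercRepro2
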